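import Summits.AtomisticToContinuum.HydrodynamicLimit.Theorems.AntiMazurCoboundariesKineticFluxLdDecayHTheoremObjectsC
import HarnessLib

/-!
# Objects of the crux line `h-theorem-dissipation-budget`, part D: BOUNDED WINDOWS ARE FREE, THE `A·s` TERM IS IDLE
# (crux `KineticFluxLdDecay`, stmt-AtomisticToContinuum-10967; lead c4, reshape 3)

Why a part D. The one open stub of the line after lead a2 is the bet on the crux's own tilt,
`NoPerpetualDissipationTilt` (part C): `∫₀ʰ 𝒟(cut one-body density of G_N^X at t) dt ≤ (h/τ)(A·s + B)` for EVERY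
window `τ > 0`, `s = KL(G_N^X ‖ G_N)/(N+1)`. Two elementary facts take the bounded windows and the `A·s` term out
of it, so that the registered open content is exactly its large-window, `A`-free core:

* `FirstMomentBudget` — **entropy budgets the first velocity moment of the reduced one-body law**, uniformly in
  the time, the flow and `N`: `∫ ‖w‖ df_t ≤ c₀ + KL(ν ‖ G_N)/(N+1)` for every probability law `ν` of finite relative
  entropy (Donsker–Varadhan with the velocity-normalised one-body tests `min(‖w‖, n) − log Z_n`, the landed
  `integral_oneBodyLaw_le_klDiv`, and a Fernique constant of the standard Gaussian on `ℝ³`, `c₀ = log ∫ e^{‖w‖} dγ`).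
* `CutProductionLeMoment` — **a-priori bound on the Hellinger production below a density cut**: for every finite
  one-body law `f ≪ vol ⊗ γ` and every cut level `K ≥ 0`,
  `𝒟(1_{n ≤ K} · df/dm) ≤ c·K·∫ ‖w‖ df` (pointwise `(√(ρ'ρ'_*) − √(ρρ_*))² ≤ ρ'ρ'_* + ρρ_*`, the gain half equals
  the loss half by the measure-preserving collision involution `(v, v_*, ω) ↦ (v', v_*', −ω)` fixing `B M M_*`,
  `B = ((v − v_*)·ω)₊ ≤ ‖v‖ + ‖v_*‖`, Tonelli, and `∫ ρ(x, w) γ(dw) = n(x) ≤ K` on the kept fibres). It is a TRUE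
  `∀f` statement (unlike the `∀ν` BUDGETS refuted in `Theorems/KineticFluxLdDecay/Negative/HTheoremMixture*`):
  an instantaneous bound, not a time-integrated budget.
* `LargeWindowDissipationTilt` — **the core of the bet**: for admissible `φ, g` and every cut `K ≥ 1` there are
  `τ₀` and `B ≥ 0` with `∫₀ʰ 𝒟(cut one-body density of G_N^X at t) dt ≤ (h/τ)·B = (N+1)^{-1/3} B` for every window
  `τ > τ₀`, all large `N` and every flow — bounded TOTAL cut dissipation of the optimal enemy over arbitrarily long
  kinetic windows (at linear response the total is `≍ κ²/(τ σ⁴ θ)·(N+1)^{-1/3} → 0`; the bet only needs bounded).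

Composition (`Theorems/…HTheoremBoundedWindows.lean`): `FirstMomentBudget → CutProductionLeMoment →
LargeWindowDissipationTilt → NoPerpetualDissipationTilt` (windows `τ ≤ τ₀` cost `h·cK(c₀ + s) ≤ (h/τ)·τ₀cK(c₀ + s)`),
and conversely `NoPerpetualDissipationTilt → LargeWindowDissipationTilt` (`s ≤ 2κ_b` since `|X| ≤ (N+1)κ_b`): the
reshape loses nothing.
-/

noncomputable section

open MeasureTheory ProbabilityTheory Set Filter InformationTheory
open scoped ENNReal

namespace Summit.AtomisticToContinuum.HydrodynamicLimit.Theorems.HTheorem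

open Literature.MathematicalPhysics.KineticTheory (T3 V3 hsDiameter localGibbsLaw)
open Literature.Analysis.FluidPDE (HardSphereFlow Config)

/-- Statement of `stub_firstMomentBudget` — **finite entropy budgets the first velocity moment of the reduced
one-body law**: there is an absolute constant `c₀ ≥ 0` such that in the crux frame (`a, θ > 0`, `σ ≤ 1/2`), for
every probability law `ν` with `KL(ν ‖ G_N) < ∞`, every time `t`, every flow and every `N`,
`∫⁻ ‖w‖ df_t ≤ c₀ + KL(ν ‖ G_N)/(N+1)`.
Proof plan: the landed one-body Donsker–Varadhan test `integral_oneBodyLaw_le_klDiv` with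
`g_n(x, w) = min(‖w‖, n) − log Z_n`, `Z_n = ∫ e^{min(‖w‖, n)} dγ ∈ [1, Z_∞]`, `Z_∞ = ∫ e^{‖w‖} dγ < ∞` (Fernique,
`IsGaussian.exists_integrable_exp_sq (stdGaussian V3)` and `‖w‖ ≤ 1/(4c) + c‖w‖²`); `c₀ = log Z_∞`; monotone
convergence in `n`. -/
def FirstMomentBudget : Prop :=
  ∃ c₀ : ℝ, 0 ≤ c₀ ∧ ∀ (σ a θ : ℝ) (u₀ : V3) (N : ℕ) (Φ : Flow σ N) (ν : Measure (Phase N)),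
    IsProbabilityMeasure ν → 0 < a → 0 < θ → σ ≤ 1 / 2 →
    klDiv ν (gibbs σ a θ u₀ N Φ) ≠ ⊤ → ∀ t : ℝ,
      ∫⁻ y, ‖y.2‖ₑ ∂(oneBodyLaw θ u₀ Φ ν t) ≤
        ENNReal.ofReal (c₀ + (klDiv ν (gibbs σ a θ u₀ N Φ)).toReal / ((N + 1 : ℕ) : ℝ))

/-- Statement of `stub_cutProductionLeMoment` — **a-priori bound on the Hellinger production below a density
cut**: there is an absolute constant `c ≥ 0` such that for every finite one-body law `f ≪ m = vol ⊗ γ` on `𝕋³ × ℝ³`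
and every cut level `K ≥ 0`, the production of the density `df/dm` with the fibres `{x | n(x) > K}` zeroed
(`n = d f₁/d vol` the position density; this is literally `cutDensity K` when `f` is a reduced one-body law) is at
most `c · K · ∫⁻ ‖w‖ df`.
Proof plan: fibrewise `(√(ρ'ρ'_*) − √(ρρ_*))² ≤ ρ'ρ'_* + ρρ_*`; the gain half equals the loss half
(`lintegral_collisionDensity_mul_comp_collide_negDir`, the involution `(v, v_*, ω) ↦ (v', v_*', −ω)` preserves
`dv dv_* dω` and `B M M_*`); `B = ((v − v_*)·ω)₊ ≤ ‖v‖ + ‖v_*‖` and `∫ dω < ∞`, so a kept fibre produces at most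
`4|S²| n(x) ∫ ‖w‖ ρ(x, w) γ(dw)` with `n(x) = ∫ ρ(x, w) γ(dw) ≤ K` (`f₁ = (∫ ρ dγ) · vol`, `Measure.rnDeriv_withDensity`);
Tonelli in `x`; `c = 4 |S²|`. -/
def CutProductionLeMoment : Prop :=
  ∃ c : ℝ, 0 ≤ c ∧ ∀ f : Measure (T3 × V3), IsFiniteMeasure f → f ≪ refMeasure → ∀ K : ℝ, 0 ≤ K →
    production (Set.indicator ({x | (f.fst.rnDeriv volume x).toReal ≤ K} ×ˢ Set.univ)
        (fun y => (f.rnDeriv refMeasure y).toReal)) ≤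
      ENNReal.ofReal (c * K) * ∫⁻ y, ‖y.2‖ₑ ∂f

/-- Statement of `stub_largeWindowDissipationTilt` — **the `A`-free large-window core of the bet `C⁺_{K,X}`
(the one deterministic, `N`-uniform stub of the line).** For constant profiles `(a, θ, u₀)` and small reduced
density `σ < σ₀` there is an amplitude `κ_b > 0` such that for all continuous `|φ| ≤ 1`, `|g| ≤ κ_b` with
`g ⊥ span{1, v, |v|²}` and every cut level `K ≥ 1` there are a window threshold `τ₀` and a constant `B ≥ 0` such
that for every kinetic window `τ > τ₀`, all large `N` and every flow, the TOTAL Hellinger production of the cut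
reduced one-body density of the tilted law `G_N^X` over the window `h = τ(N+1)^{-1/3}` is at most
`(h/τ)·B = (N+1)^{-1/3} B`: the crux's optimal enemy dissipates a bounded total amount however long the kinetic
window. Equivalent to `NoPerpetualDissipationTilt` given `FirstMomentBudget` and `CutProductionLeMoment`
(bounded windows are free; `s ≤ 2κ_b` makes the `A·s` term idle). Content: Lanford-type incoming chaos for `G_N^X`
at FIXED `σ` over kinetic windows `τ → ∞`, in time-integrated entropy-production currency — the open core. -/
def LargeWindowDissipationTilt : Prop :=
  ∀ (a θ : ℝ) (u₀ : V3), 0 < a → 0 < θ → ∃ σ₀ : ℝ, 0 < σ₀ ∧ ∀ σ : ℝ, 0 < σ → σ < σ₀ →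
    ∃ κb : ℝ, 0 < κb ∧ ∀ (φ : T3 → ℝ) (g : V3 → ℝ), Continuous φ → Continuous g →
      (∀ x, |φ x| ≤ 1) → (∀ w, |g w| ≤ κb) → Orthogonal g →
      ∀ K : ℝ, 1 ≤ K → ∃ τ₀ B : ℝ, 0 ≤ B ∧ ∀ τ : ℝ, τ₀ < τ → ∃ N₀ : ℕ, ∀ N : ℕ, N₀ ≤ N →
        ∀ Φ : Flow σ N,
          ∫⁻ t in Set.Ioo 0 (window τ N),
              production (cutDensity K θ u₀ Φ (tiltedGibbs σ a θ u₀ φ g τ N Φ) t) ≤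
            ENNReal.ofReal (window τ N / τ * B)

/-! ### Bookkeeping sub-goal of part D -/

/-- Statement of the bookkeeping sub-goal `stub_hTheoremObjectsD`: the cut of `CutProductionLeMoment` at the reduced
one-body law IS the line's `cutDensity` (so the a-priori bound applies to the composition's densities by `rfl`). -/
def HTheoremObjectsDBasic : Prop :=
  ∀ (ε : ℝ) (n : ℕ) (K θ : ℝ) (u₀ : V3) (Φ : TFlow ε n) (ν : Measure (TPhase n)) (t : ℝ),
    cutDensity K θ u₀ Φ ν t =
      Set.indicator ({x | ((oneBodyLaw θ u₀ Φ ν t).fst.rnDeriv volume x).toReal ≤ K} ×ˢ Set.univ)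
        (fun y => ((oneBodyLaw θ u₀ Φ ν t).rnDeriv refMeasure y).toReal)

/-- **Bookkeeping sub-goal of part D** (`stub_hTheoremObjectsD`). -/
theorem stub_hTheoremObjectsD : HTheoremObjectsDBasic := fun _ _ _ _ _ _ _ _ => rfl

end Summit.AtomisticToContinuum.HydrodynamicLimit.Theorems.HTheorem

end
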